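import Mathlib
import Summits.AtomisticToContinuum.HydrodynamicLimit.Theorems.ImplosionDichotomyDenseExcursionSonicCavityDefs

/-!
# The holomorphic coefficient package of the order-`k` packing problem at the sonic point
# (crux `DenseExcursion`, stmt-AtomisticToContinuum-12586, line `sonic-cavity-renewal` v9, stub `stub_analyticPackingImplosion`)

Helper file (`--supports stmt-AtomisticToContinuum-12586`, line lead a2, wave-5 worker D2, task `sonicWindow_analytic_bound`,
worker reports `work/stubs/D1_gammaClosure.REPORT.md` §3.3 (`sonicTriangle_profile`) and `D2_triangle.REPORT.md`).

In the characteristic variables `P = u₁ + 3u₂`, `M = u₁ − 3u₂` the complexified resolvent system at packing order `Λ` reads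
`c₊ P′ = (Λ − b₊₊)P − b₊₋M − F₊`, `c₋ M′ = (Λ − b₋₋)M − b₋₊P − F₋` with `c± = W − 1 ± S` and `b`'s affine in
`W, W′, S, S′` (complex extensions `Wc, Sc` of the profile, `cavityTube_complex_extension`). Everything the sup-norm window
estimate on the complex sonic triangle needs about the PROFILE is packaged here, SOFTLY (existential radius, by continuity at
the sonic point — no certified numerics beyond `CavityTube` (a), (c) at `x = 0`):

* `sonicTriangle_profile` (REGISTERED helper): there are `R₀ ∈ (0, 1/10]`, the repulsivity `κ = −(W′ + S′)(0) ≥ 2/5`,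
  constants `Cb, Ce ≥ 0` and holomorphic `d = dslope c₊ 0`, `e = dslope d 0` on the disc `‖z‖ < 1/10` with the exact
  factorisations `c₊(z) = z·d(z)`, `d(z) − d(0) = z·e(z)`, `d(0) = −κ`, and on `‖z‖ < R₀` the bounds
  `Re d ≤ −κ/2`, `‖d‖ ≤ 2κ`, `‖e‖ ≤ Ce`, `Re c₋ ≤ −1`, `|Im c₋| ≤ 1/5`, `‖c₋‖ ≤ 3`, `‖Wc‖, ‖Wc′‖, ‖Sc‖, ‖Sc′‖ ≤ Cb`
  (`c₋(0) = −2S(0) ∈ [−2, −7/5]` by (a) and (c)).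

Sources: standard (removable singularity `dslope`, `Complex.differentiableOn_dslope`). NOT here: any estimate on solutions.
-/

noncomputable section

open Set Metric Filter Topology

namespace Summit.AtomisticToContinuum.HydrodynamicLimit.Theorems.PackingAnalyticImplosion

open Summit.AtomisticToContinuum.HydrodynamicLimit.Theorems.R2OneModeTwoConditions
open Summit.AtomisticToContinuum.HydrodynamicLimit.Theorems.SonicCavityRenewal

/-- Local boundedness at `0` of a function continuous at `0`: `‖g z‖ ≤ ‖g 0‖ + 1` on a small disc. [folklore] -/
theorem exists_ball_norm_le_of_continuousAt {g : ℂ → ℂ} (hg : ContinuousAt g 0) :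
    ∃ δ : ℝ, 0 < δ ∧ ∀ z ∈ ball (0 : ℂ) δ, ‖g z‖ ≤ ‖g 0‖ + 1 := by
  obtain ⟨δ, hδ, h⟩ := Metric.continuousAt_iff.1 hg 1 one_pos
  refine ⟨δ, hδ, fun z hz => ?_⟩
  have h1 : dist (g z) (g 0) < 1 := h (by simpa using hz)
  rw [dist_eq_norm] at h1
  calc ‖g z‖ = ‖(g z - g 0) + g 0‖ := by rw [sub_add_cancel]
    _ ≤ ‖g z - g 0‖ + ‖g 0‖ := norm_add_le _ _
    _ ≤ ‖g 0‖ + 1 := by linarith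

/-- Closeness at `0`: `‖g z − g 0‖ < ε` on a small disc. [folklore] -/
theorem exists_ball_norm_sub_lt_of_continuousAt {g : ℂ → ℂ} (hg : ContinuousAt g 0) {ε : ℝ} (hε : 0 < ε) :
    ∃ δ : ℝ, 0 < δ ∧ ∀ z ∈ ball (0 : ℂ) δ, ‖g z - g 0‖ < ε := by
  obtain ⟨δ, hδ, h⟩ := Metric.continuousAt_iff.1 hg ε hε
  refine ⟨δ, hδ, fun z hz => ?_⟩
  have h1 : dist (g z) (g 0) < ε := h (by simpa using hz)
  rwa [dist_eq_norm] at h1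

/-- **THE HOLOMORPHIC COEFFICIENT PACKAGE AT THE SONIC POINT** (registered helper `sonicTriangle_profile` of
`stub_analyticPackingImplosion`): factorisation `c₊ = z·d`, `d − d(0) = z·e`, `d(0) = −κ ≤ −2/5`, and uniform bounds for
`d, e, c₋ = W − 1 − S, W, W′, S, S′` on a disc `‖z‖ < R₀` around the sonic point, for any holomorphic extension `(Wc, Sc)` of the
profile on `‖z‖ < 1/10` (`cavityTube_complex_extension`). [folklore] -/
theorem sonicTriangle_profile : ∀ (r : ℝ) (W S : ℝ → ℝ) (Wc Sc : ℂ → ℂ), IsMonatomicProfile r W S → CavityTube r W S → AnalyticOnNhd ℂ Wc (Metric.ball 0 (1 / 10)) → AnalyticOnNhd ℂ Sc (Metric.ball 0 (1 / 10)) → (∀ x : ℝ, |x| < 1 / 10 → Wc (x : ℂ) = ((W x : ℝ) : ℂ) ∧ Sc (x : ℂ) = ((S x : ℝ) : ℂ) ∧ deriv Wc (x : ℂ) = ((deriv W x : ℝ) : ℂ) ∧ deriv Sc (x : ℂ) = ((deriv S x : ℝ) : ℂ)) → ∃ (R₀ κ Cb Ce : ℝ) (d e : ℂ → ℂ), 0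 < R₀ ∧ R₀ ≤ 1 / 10 ∧ 2 / 5 ≤ κ ∧ 0 ≤ Cb ∧ 0 ≤ Ce ∧ DifferentiableOn ℂ d (Metric.ball 0 (1 / 10)) ∧ DifferentiableOn ℂ e (Metric.ball 0 (1 / 10)) ∧ (∀ z ∈ Metric.ball (0 : ℂ) (1 / 10), Wc z - 1 + Sc z = z * d z ∧ d z - d 0 = z * e z) ∧ d 0 = -(κ : ℂ) ∧ ∀ z ∈ Metric.ball (0 : ℂ) R₀, (d z).re ≤ -(κ / 2) ∧ ‖d z‖ ≤ 2 * κ ∧ ‖e z‖ ≤ Ce ∧ (Wc z - 1 - Sc z).re ≤ -1 ∧ |(Wc z - 1 - Sc z).im| ≤ 1 / 5 ∧ ‖Wc z - 1 - Sc z‖ ≤ 3 ∧ ‖Wc z‖ ≤ Cb ∧ ‖deriv Wc z‖ ≤ Cb ∧ ‖Sc z‖ ≤ Cb ∧ ‖deriv Sc z‖ ≤ Cb := by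
  intro r W S Wc Sc hprof htube hWc hSc hext
  -- the data at the sonic point
  have hsonic : W 0 + S 0 = 1 := htube.1
  have hκ' : deriv W 0 + deriv S 0 ≤ -(2 / 5) := htube.2.2.2.2.1
  have hS0 : 7 / 10 ≤ S 0 ∧ S 0 ≤ 1 := by
    have h := (htube.2.2.2.2.2.2.2.2.1) 0 (by norm_num)
    simpa using And.intro h.1 h.2.1
  obtain ⟨hW0, hS0c, hW0', hS0'⟩ := hext 0 (by norm_num)
  simp only [Complex.ofReal_zero] at hW0 hS0c hW0' hS0'
  set κ : ℝ := -(deriv W 0 + deriv S 0) with hκdef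
  have hκ : 2 / 5 ≤ κ := by simp only [hκdef]; linarith
  -- holomorphy on the disc
  have hball : ball (0 : ℂ) (1 / 10) ∈ 𝓝 (0 : ℂ) := isOpen_ball.mem_nhds (mem_ball_self (by norm_num))
  have hWd : DifferentiableOn ℂ Wc (ball 0 (1 / 10)) := hWc.differentiableOn
  have hSd : DifferentiableOn ℂ Sc (ball 0 (1 / 10)) := hSc.differentiableOn
  have hWd' : DifferentiableOn ℂ (deriv Wc) (ball 0 (1 / 10)) := (hWc.deriv).differentiableOn
  have hSd' : DifferentiableOn ℂ (deriv Sc) (ball 0 (1 / 10)) := (hSc.deriv).differentiableOn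
  set cp : ℂ → ℂ := fun z => Wc z - 1 + Sc z with hcp
  have hcpd : DifferentiableOn ℂ cp (ball 0 (1 / 10)) := (hWd.sub_const 1).add hSd
  have hcp0 : cp 0 = 0 := by
    simp only [hcp, hW0, hS0c]
    have : ((W 0 : ℝ) : ℂ) - 1 + ((S 0 : ℝ) : ℂ) = (((W 0 + S 0 - 1 : ℝ)) : ℂ) := by push_cast; ring
    rw [this, hsonic]; simp
  have hcp'0 : deriv cp 0 = -(κ : ℂ) := by
    have h0 : (0 : ℂ) ∈ ball (0 : ℂ) (1 / 10) := mem_ball_self (by norm_num)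
    have h1 : HasDerivAt Wc (deriv Wc 0) 0 := (hWd.differentiableAt hball).hasDerivAt
    have h2 : HasDerivAt Sc (deriv Sc 0) 0 := (hSd.differentiableAt hball).hasDerivAt
    have h3 : HasDerivAt cp (deriv Wc 0 + deriv Sc 0) 0 := by
      exact (h1.sub_const 1).fun_add h2
    rw [h3.deriv, hW0', hS0', hκdef]
    push_cast; ring
  set d : ℂ → ℂ := dslope cp 0 with hd
  have hdd : DifferentiableOn ℂ d (ball 0 (1 / 10)) := (Complex.differentiableOn_dslope hball).2 hcpd
  have hd0 : d 0 = -(κ : ℂ) := by rw [hd, dslope_same, hcp'0]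
  have hfac1 : ∀ z, cp z = z * d z := by
    intro z
    have h := sub_smul_dslope cp 0 z
    rw [sub_zero, smul_eq_mul, hcp0, sub_zero] at h
    exact h.symm
  set e : ℂ → ℂ := dslope d 0 with he
  have hed : DifferentiableOn ℂ e (ball 0 (1 / 10)) := (Complex.differentiableOn_dslope hball).2 hdd
  have hfac2 : ∀ z, d z - d 0 = z * e z := by
    intro z
    have h := sub_smul_dslope d 0 z
    rw [sub_zero, smul_eq_mul] at h
    exact h.symm
  -- continuity at 0 of everything
  have cW : ContinuousAt Wc 0 := (hWd.differentiableAt hball).continuousAt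
  have cS : ContinuousAt Sc 0 := (hSd.differentiableAt hball).continuousAt
  have cW' : ContinuousAt (deriv Wc) 0 := (hWd'.differentiableAt hball).continuousAt
  have cS' : ContinuousAt (deriv Sc) 0 := (hSd'.differentiableAt hball).continuousAt
  have cd : ContinuousAt d 0 := (hdd.differentiableAt hball).continuousAt
  have ce : ContinuousAt e 0 := (hed.differentiableAt hball).continuousAt
  have ccm : ContinuousAt (fun z => Wc z - 1 - Sc z) 0 := (cW.sub continuousAt_const).sub cS
  -- the radii
  obtain ⟨δ₁, hδ₁, hB₁⟩ := exists_ball_norm_le_of_continuousAt cW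
  obtain ⟨δ₂, hδ₂, hB₂⟩ := exists_ball_norm_le_of_continuousAt cS
  obtain ⟨δ₃, hδ₃, hB₃⟩ := exists_ball_norm_le_of_continuousAt cW'
  obtain ⟨δ₄, hδ₄, hB₄⟩ := exists_ball_norm_le_of_continuousAt cS'
  obtain ⟨δ₅, hδ₅, hB₅⟩ := exists_ball_norm_le_of_continuousAt ce
  have hκpos : 0 < κ / 2 := by linarith
  obtain ⟨δ₆, hδ₆, hB₆⟩ := exists_ball_norm_sub_lt_of_continuousAt cd hκpos
  obtain ⟨δ₇, hδ₇, hB₇⟩ := exists_ball_norm_sub_lt_of_continuousAt ccm (by norm_num : (0 : ℝ) < 1 / 5)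
  set Cb : ℝ := max (max (‖Wc 0‖ + 1) (‖Sc 0‖ + 1)) (max (‖deriv Wc 0‖ + 1) (‖deriv Sc 0‖ + 1)) with hCb
  set R₀ : ℝ := min (min (min δ₁ δ₂) (min δ₃ δ₄)) (min (min δ₅ δ₆) (min δ₇ (1 / 10))) with hR₀
  have hR₀pos : 0 < R₀ := by
    simp only [hR₀, lt_min_iff]
    exact ⟨⟨⟨hδ₁, hδ₂⟩, ⟨hδ₃, hδ₄⟩⟩, ⟨⟨hδ₅, hδ₆⟩, ⟨hδ₇, by norm_num⟩⟩⟩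
  have hR₀le : R₀ ≤ 1 / 10 := by
    simp only [hR₀]
    exact (min_le_right _ _).trans ((min_le_right _ _).trans (min_le_right _ _))
  have hsub : ∀ {δ : ℝ}, R₀ ≤ δ → ∀ {z : ℂ}, z ∈ ball (0 : ℂ) R₀ → z ∈ ball (0 : ℂ) δ :=
    fun hle z hz => ball_subset_ball hle hz
  have hR₁ : R₀ ≤ δ₁ := by simp only [hR₀]; exact (min_le_left _ _).trans ((min_le_left _ _).trans (min_le_left _ _))
  have hR₂ : R₀ ≤ δ₂ := by simp only [hR₀]; exact (min_le_left _ _).trans ((min_le_left _ _).trans (min_le_right _ _))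
  have hR₃ : R₀ ≤ δ₃ := by simp only [hR₀]; exact (min_le_left _ _).trans ((min_le_right _ _).trans (min_le_left _ _))
  have hR₄ : R₀ ≤ δ₄ := by simp only [hR₀]; exact (min_le_left _ _).trans ((min_le_right _ _).trans (min_le_right _ _))
  have hR₅ : R₀ ≤ δ₅ := by simp only [hR₀]; exact (min_le_right _ _).trans ((min_le_left _ _).trans (min_le_left _ _))
  have hR₆ : R₀ ≤ δ₆ := by simp only [hR₀]; exact (min_le_right _ _).trans ((min_le_left _ _).trans (min_le_right _ _))
  have hR₇ : R₀ ≤ δ₇ := by simp only [hR₀]; exact (min_le_right _ _).trans ((min_le_right _ _).trans (min_le_left _ _))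
  have hCb0 : 0 ≤ Cb := by
    simp only [hCb]; exact le_max_of_le_left (le_max_of_le_left (by positivity))
  refine ⟨R₀, κ, Cb, ‖e 0‖ + 1, d, e, hR₀pos, hR₀le, hκ, hCb0, by positivity, hdd, hed,
    fun z _ => ⟨hfac1 z, hfac2 z⟩, hd0, fun z hz => ?_⟩
  -- the bounds on the small disc
  have h6 := hB₆ z (hsub hR₆ hz)
  rw [hd0] at h6
  have h6re : |(d z).re - (-κ)| ≤ ‖d z - -(κ : ℂ)‖ := by
    have := Complex.abs_re_le_norm (d z - -(κ : ℂ))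
    simpa using this
  have h7 := hB₇ z (hsub hR₇ hz)
  have hcm0 : Wc 0 - 1 - Sc 0 = ((-(2 * S 0) : ℝ) : ℂ) := by
    rw [hW0, hS0c]
    have : W 0 = 1 - S 0 := by linarith
    rw [this]; push_cast; ring
  rw [hcm0] at h7
  have h7re : |(Wc z - 1 - Sc z).re - (-(2 * S 0))| ≤ ‖Wc z - 1 - Sc z - ((-(2 * S 0) : ℝ) : ℂ)‖ := by
    have := Complex.abs_re_le_norm (Wc z - 1 - Sc z - ((-(2 * S 0) : ℝ) : ℂ))
    simpa using this
  have h7im : |(Wc z - 1 - Sc z).im| ≤ ‖Wc z - 1 - Sc z - ((-(2 * S 0) : ℝ) : ℂ)‖ := by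
    have := Complex.abs_im_le_norm (Wc z - 1 - Sc z - ((-(2 * S 0) : ℝ) : ℂ))
    simpa using this
  refine ⟨?_, ?_, hB₅ z (hsub hR₅ hz), ?_, ?_, ?_, ?_, ?_, ?_, ?_⟩
  · have := (abs_le.1 (h6re.trans h6.le)).2
    linarith
  · calc ‖d z‖ = ‖(d z - -(κ : ℂ)) + -(κ : ℂ)‖ := by rw [sub_add_cancel]
      _ ≤ ‖d z - -(κ : ℂ)‖ + ‖-(κ : ℂ)‖ := norm_add_le _ _
      _ ≤ κ / 2 + κ := by
          have : ‖-(κ : ℂ)‖ = κ := by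
            rw [norm_neg, Complex.norm_real, Real.norm_eq_abs, abs_of_nonneg (by linarith)]
          rw [this]; linarith
      _ ≤ 2 * κ := by linarith
  · have := (abs_le.1 (h7re.trans h7.le)).2
    linarith [hS0.1]
  · exact h7im.trans (h7.le)
  · calc ‖Wc z - 1 - Sc z‖ = ‖(Wc z - 1 - Sc z - ((-(2 * S 0) : ℝ) : ℂ)) + ((-(2 * S 0) : ℝ) : ℂ)‖ := by
          rw [sub_add_cancel]
      _ ≤ ‖Wc z - 1 - Sc z - ((-(2 * S 0) : ℝ) : ℂ)‖ + ‖((-(2 * S 0) : ℝ) : ℂ)‖ := norm_add_le _ _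
      _ ≤ 1 / 5 + 2 := by
          have : ‖((-(2 * S 0) : ℝ) : ℂ)‖ = 2 * S 0 := by
            rw [Complex.norm_real, Real.norm_eq_abs, abs_of_nonpos (by linarith [hS0.1])]; ring
          rw [this]; linarith [hS0.2]
      _ ≤ 3 := by norm_num
  · exact (hB₁ z (hsub hR₁ hz)).trans (by simp only [hCb]; exact le_max_of_le_left (le_max_left _ _))
  · exact (hB₃ z (hsub hR₃ hz)).trans (by simp only [hCb]; exact le_max_of_le_right (le_max_left _ _))
  · exact (hB₂ z (hsub hR₂ hz)).trans (by simp only [hCb]; exact le_max_of_le_left (le_max_right _ _))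
  · exact (hB₄ z (hsub hR₄ hz)).trans (by simp only [hCb]; exact le_max_of_le_right (le_max_right _ _))

end Summit.AtomisticToContinuum.HydrodynamicLimit.Theorems.PackingAnalyticImplosion

end
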